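import Summits.RiemannHypothesis.RiemannHypothesis.Theorems.EtaLeadingQuarterSecondMomentAFEFreq
import HarnessLib

/-!
# Sharp-ended eta vector at the zeros, III: the refined approximate functional equation,
# master inequality (route EtaLeadingQuarter, item `EtaLeadingSecondMoment`,
# stmt-RiemannHypothesis-21791)

Titchmarsh's §4.13 assembled (as in the tree's `AFE.norm_zeta_sub_sub_le_master`) for
`s = 1/2 + it`, an INTEGER abscissa `a = X ≥ 1`, `y = t/(2πX)` ARBITRARY (`> 0`), with the main
term `X^{1-s}/(1-s)` kept on the left (it cancels in the alternating combination
`2^{1-s} P(L) − P(2L)`), the second sum over `ν ≤ [y]` exactly, and the two frequencies adjacent to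
`y` estimated with boundary layers `Δ₀, Δ₁` (parts I–II; part II in its critical-line form
`EtaLeadingQuarterSecondMomentAFEFreq.lean`). All parameters `N, V, Δ₀, Δ₁` are
explicit here; part IV chooses them.

RH-free real analysis. Nothing here bears on the truth of RH.
-/

noncomputable section

open Complex MeasureTheory Set Filter intervalIntegral Finset
open scoped Real Topology Interval

set_option linter.dupNamespace false  -- the mandated namespace repeats `RiemannHypothesis`

namespace Summit.RiemannHypothesis.RiemannHypothesis.Theorems.EtaLeadingQuarter.SecondMomentAFE

open Literature.NumberTheory.LFunctions Literature.NumberTheory.LFunctions.AFE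
open Summit.RiemannHypothesis.RiemannHypothesis.Theorems.EtaLeadingQuarter.SecondMomentAFE.Freq

/-- **The refined master inequality.** For `s = 1/2 + it`, `t > 0`, an integer abscissa
`a = X ≥ 1`, `y = t/(2πX)`, `n = [y]`, boundary layers `0 ≤ Δ₀ ≤ X/2` (with `X{y} + nΔ₀ > 0` when
`n ≥ 1`) and `0 ≤ Δ₁`, and auxiliary `N ≥ X + Δ₁` with `t ≤ πN`, `V ≥ n + 1`, the quantity
`‖ζ(s) − ∑_{m ≤ X} m^{-s} + X^{1-s}/(1-s) − afeCoeff(s) ∑_{ν ≤ n} ν^{s-1}‖` is at most the sum of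
the error terms of Titchmarsh's §4.13 in the following form: Euler–Maclaurin
`N^{-1/2}(1/2+‖s‖)`; truncated-Poisson remainder `‖s‖X^{-3/2}(N − X + 2)η_V`; sawtooth terms
`X^{-1/2}/2 + N^{-1/2}/2`; generic near frequencies
`(4N^{-1/2}/π + 2X^{-1/2}/π)(1 + log n) + (n−1)X^{1/2}/t`; the near frequency `ν = n` (if `n ≥ 1`)
`4N^{-1/2}/π + X^{1/2}/t + Δ₀(X/2)^{-1/2} + (2/π)X^{1/2}/(X{y} + nΔ₀)`; integrated terms
`((N^{-1/2} + X^{-1/2})/(2π))(1 + log(n+1))`; generic far frequencies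
`‖s‖X^{-3/2}(1 + log(n+2))/(π²(n+1))`; the far frequency `ν = n+1`
`(‖s‖/(2π(n+1)))(Δ₁X^{-3/2} + (2/π)X^{-1/2}/(X(1−{y}) + (n+1)Δ₁))`; negative frequencies
`2‖s‖X^{-1/2}(1 + log(n+1))/(πt) + ‖s‖X^{-3/2}/(π²n)` if `y ≥ 1`, `2‖s‖X^{-3/2}/π²` if `y < 1`.
[folklore] -/
theorem norm_zeta_sub_refined_master {t : ℝ} {X N V : ℕ} {Δ₀ Δ₁ : ℝ} (ht0 : 0 < t) (hX1 : 1 ≤ X)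
    (hΔ0 : 0 ≤ Δ₀) (hΔ0a : Δ₀ ≤ X / 2)
    (hΔ0pos : 1 ≤ ⌊t / (2 * π * X)⌋₊ → 0 < X * Int.fract (t / (2 * π * X)) + ⌊t / (2 * π * X)⌋₊ * Δ₀)
    (hΔ1 : 0 ≤ Δ₁) (haN : (X : ℝ) + Δ₁ ≤ N) (htN : t ≤ π * N)
    (hyV : ⌊t / (2 * π * X)⌋₊ + 1 ≤ V) (s : ℂ) (hs : s = 1 / 2 + t * I) :
    ‖riemannZeta s - ∑ n ∈ Finset.Icc 1 X, (n : ℂ) ^ (-s) + (X : ℂ) ^ (1 - s) / (1 - s)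
        - afeCoeff s * ∑ n ∈ Finset.Icc 1 ⌊t / (2 * π * X)⌋₊, (n : ℂ) ^ (s - 1)‖
      ≤ (N : ℝ) ^ (-(1 / 2 : ℝ)) * (1 / 2 + ‖s‖)
        + ‖s‖ * (X : ℝ) ^ (-(1 / 2 : ℝ) - 1) * (N - X + 2) * sawEta V
        + (X : ℝ) ^ (-(1 / 2 : ℝ)) / 2
        + (N : ℝ) ^ (-(1 / 2 : ℝ)) / 2
        + (4 * (N : ℝ) ^ (-(1 / 2 : ℝ)) / π * (1 + Real.log ⌊t / (2 * π * X)⌋₊)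
            + (⌊t / (2 * π * X)⌋₊ - 1 : ℕ) * ((X : ℝ) ^ (1 / 2 : ℝ) / t)
            + 2 / π * (X : ℝ) ^ (-(1 / 2 : ℝ)) * (1 + Real.log ⌊t / (2 * π * X)⌋₊))
        + (if 1 ≤ ⌊t / (2 * π * X)⌋₊ then
            4 * (N : ℝ) ^ (-(1 / 2 : ℝ)) / π + (X : ℝ) ^ (1 / 2 : ℝ) / t else 0)
        + ((N : ℝ) ^ (-(1 / 2 : ℝ)) + (X : ℝ) ^ (-(1 / 2 : ℝ))) / (2 * π)
            * (1 + Real.log (⌊t / (2 * π * X)⌋₊ + 1))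
        + ‖s‖ * (X : ℝ) ^ (-(1 / 2 : ℝ) - 1) / π ^ 2
            * ((1 + Real.log (⌊t / (2 * π * X)⌋₊ + 2)) / (⌊t / (2 * π * X)⌋₊ + 1))
        + ‖s‖ / (2 * π * (⌊t / (2 * π * X)⌋₊ + 1)) * (Δ₁ * (X : ℝ) ^ (-(1 / 2 : ℝ) - 1)
            + 2 / π * (X : ℝ) ^ (-(1 / 2 : ℝ))
              / (X * (1 - Int.fract (t / (2 * π * X))) + (⌊t / (2 * π * X)⌋₊ + 1) * Δ₁))
        + (if 1 ≤ ⌊t / (2 * π * X)⌋₊ then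
            Δ₀ * ((X : ℝ) / 2) ^ (-(1 / 2 : ℝ)) + 2 / π * (X : ℝ) ^ (1 / 2 : ℝ)
              / (X * Int.fract (t / (2 * π * X)) + ⌊t / (2 * π * X)⌋₊ * Δ₀) else 0)
        + (if (1 : ℝ) ≤ t / (2 * π * X) then
            2 * ‖s‖ * (X : ℝ) ^ (-(1 / 2 : ℝ)) / (π * t) * (1 + Real.log (⌊t / (2 * π * X)⌋₊ + 1))
              + ‖s‖ * (X : ℝ) ^ (-(1 / 2 : ℝ) - 1) / π ^ 2 * (1 / ⌊t / (2 * π * X)⌋₊)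
          else 2 * ‖s‖ * (X : ℝ) ^ (-(1 / 2 : ℝ) - 1) / π ^ 2) := by
  -- abbreviations: `a = X` (real), `y = t/(2πa)`, `n = [y]`
  have hX1R : (1 : ℝ) ≤ (X : ℝ) := by exact_mod_cast hX1
  have haXc : (X : ℂ) = ((X : ℝ) : ℂ) := (Complex.ofReal_natCast X).symm
  have hfa : ⌊(X : ℝ)⌋₊ = X := Nat.floor_natCast X
  rw [haXc]
  generalize haX : (X : ℝ) = a at hΔ0a hΔ0pos haN hyV hX1R hfa ⊢
  set y : ℝ := t / (2 * π * a) with hydef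
  set n : ℕ := ⌊y⌋₊ with hn
  have hπ := Real.pi_pos
  have ha : 0 < a := by linarith
  have hy0 : 0 < y := by rw [hydef]; positivity
  have hty : t = 2 * π * a * y := by rw [hydef]; field_simp
  have hsre : s.re = 1 / 2 := by rw [hs]; simp
  have hsim : s.im = t := by rw [hs]; simp
  have hσ0 : 0 < s.re := by rw [hsre]; norm_num
  have hσ1 : s.re < 1 := by rw [hsre]; norm_num
  have hs1 : s ≠ 1 := by
    intro h; rw [h] at hsim; simp at hsim; linarith
  have hty' : s.im = 2 * π * a * y := by rw [hsim, hty]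
  have hNreal : a ≤ (N : ℝ) := by linarith
  have hNpos : (0 : ℝ) < N := ha.trans_le hNreal
  have hN1 : 1 ≤ N := by exact_mod_cast (show (0 : ℝ) < N from hNpos)
  have htN' : s.im ≤ π * N := by rw [hsim]; exact htN
  have hV1 : 1 ≤ V := le_trans (by omega) hyV
  have hnV : n ≤ V := le_trans (Nat.le_succ n) hyV
  have hfl : (n : ℝ) ≤ y := Nat.floor_le hy0.le
  have hfl' : y < n + 1 := Nat.lt_floor_add_one y
  have hfract : Int.fract y = y - n := by
    rw [hn, natCast_floor_eq_intCast_floor hy0.le, Int.fract]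
  -- names for the pieces (as in the tree's master proof)
  set C : ℂ := afeCoeff s with hC
  set S1 : ℂ := ∑ m ∈ Finset.Icc 1 X, (m : ℂ) ^ (-s) with hS1
  set S3 : ℂ := ∑ m ∈ Finset.Ioc ⌊a⌋₊ N, (m : ℂ) ^ (-s) with hS3
  set SN : ℂ := ∑ m ∈ Finset.Icc 1 N, (m : ℂ) ^ (-s) with hSN
  set Ip : ℕ → ℂ := fun ν => ∫ u in a..N, (u : ℂ) ^ (-s - 1)
    * Complex.exp (((2 * π * ν * u : ℝ) : ℂ) * I) with hIp
  set In : ℕ → ℂ := fun ν => ∫ u in a..N, (u : ℂ) ^ (-s - 1)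
    * Complex.exp (((-(2 * π * ν) * u : ℝ) : ℂ) * I) with hIn
  set J : ℕ → ℂ := fun ν => ∫ u in a..N, (u : ℂ) ^ (-s)
    * Complex.exp (((2 * π * ν * u : ℝ) : ℂ) * I) with hJ
  set Bd : ℕ → ℂ := fun ν => ((N : ℂ) ^ (-s) * Complex.exp (((2 * π * ν * N : ℝ) : ℂ) * I)
    - (a : ℂ) ^ (-s) * Complex.exp (((2 * π * ν * a : ℝ) : ℂ) * I)) / (2 * π * I * ν) with hBd
  set cν : ℕ → ℂ := fun ν => 1 / (2 * π * I * ν) with hcν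
  set NearP : ℂ := ∑ ν ∈ Finset.Icc 1 n, s * (cν ν * Ip ν) with hNearP
  set FarP1 : ℂ := s * (cν (n + 1) * Ip (n + 1)) with hFarP1
  set FarP2 : ℂ := ∑ ν ∈ Finset.Icc (n + 2) V, s * (cν ν * Ip ν) with hFarP2
  set Neg : ℂ := ∑ ν ∈ Finset.Icc 1 V, s * (cν ν * In ν) with hNeg
  set JS : ℂ := ∑ ν ∈ Finset.Icc 1 n, J ν with hJS
  set BS : ℂ := ∑ ν ∈ Finset.Icc 1 n, Bd ν with hBS
  set CY : ℂ := C * ∑ ν ∈ Finset.Icc 1 n, (ν : ℂ) ^ (s - 1) with hCY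
  set MainA : ℂ := ((N : ℂ) ^ (1 - s) - (a : ℂ) ^ (1 - s)) / (1 - s)
    + (saw a : ℂ) * (a : ℂ) ^ (-s) - (saw N : ℂ) * (N : ℂ) ^ (-s)
    + s * ∑ ν ∈ Finset.Icc 1 V, cν ν * (Ip ν - In ν) with hMainA
  set RA : ℂ := S3 - MainA with hRA
  set EM : ℂ := riemannZeta s - SN + (N : ℂ) ^ (1 - s) / (1 - s) with hEM
  -- (1) the sums of `m^{-s}` combine
  have hXN : X ≤ N := by
    have h : ((X : ℕ) : ℝ) ≤ (N : ℝ) := by rw [haX]; exact hNreal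
    exact_mod_cast h
  have hSsplit : SN = S1 + S3 := by
    simp only [hSN, hS1, hS3, hfa]
    rw [show Finset.Icc 1 N = Finset.Ioc 0 N from rfl, show Finset.Icc 1 X = Finset.Ioc 0 X from rfl,
      ← Finset.sum_Ioc_consecutive _ (Nat.zero_le X) hXN]
  -- (2) split of the frequency sum
  have hVsplit : s * ∑ ν ∈ Finset.Icc 1 V, cν ν * (Ip ν - In ν)
      = NearP + FarP1 + FarP2 - Neg := by
    simp only [hNearP, hFarP1, hFarP2, hNeg]
    rw [Finset.mul_sum]
    have e : ∀ ν : ℕ, s * (cν ν * (Ip ν - In ν)) = s * (cν ν * Ip ν) - s * (cν ν * In ν) := by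
      intro ν; ring
    simp only [e, Finset.sum_sub_distrib]
    have h3 : ∑ ν ∈ Finset.Icc 1 V, s * (cν ν * Ip ν)
        = ∑ ν ∈ Finset.Icc 1 n, s * (cν ν * Ip ν)
          + (s * (cν (n + 1) * Ip (n + 1)) + ∑ ν ∈ Finset.Icc (n + 2) V, s * (cν ν * Ip ν)) := by
      have e1 : Finset.Icc 1 V = Finset.Ioc 0 V := rfl
      have e2 : Finset.Icc 1 n = Finset.Ioc 0 n := rfl
      have e3 : Finset.Icc (n + 2) V = Finset.Ioc (n + 1) V :=
        Finset.Icc_add_one_left_eq_Ioc (n + 1) V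
      rw [e1, e2, e3, ← Finset.sum_Ioc_consecutive _ (Nat.zero_le n) hnV,
        ← Finset.sum_Ioc_consecutive _ (Nat.le_succ n) hyV, Nat.Ioc_succ_singleton,
        Finset.sum_singleton]
    rw [h3]; ring
  -- (3) the near terms
  have hnear : NearP = JS - BS := by
    simp only [hNearP, hJS, hBS, ← Finset.sum_sub_distrib]
    apply Finset.sum_congr rfl
    intro ν hν
    have hν : (ν : ℝ) ≠ 0 := by
      have := (Finset.mem_Icc.1 hν).1
      exact_mod_cast (show ν ≠ 0 by omega)
    have h := near_term_identity s ha hNreal hν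
    simp only [hcν, hIp, hJ, hBd]
    convert h using 2 <;> push_cast <;> ring_nf
  -- (4) the identity
  set T5e : ℂ := (saw a : ℂ) * (a : ℂ) ^ (-s) with hT5e
  set T6e : ℂ := -((saw N : ℂ) * (N : ℂ) ^ (-s)) with hT6e
  have hident : riemannZeta s - S1 + (a : ℂ) ^ (1 - s) / (1 - s) - CY
      = EM + RA + T5e + T6e + (JS - CY) + (-BS) + FarP1 + FarP2 + (-Neg) := by
    simp only [hEM, hRA, hMainA, hSsplit, hVsplit, hnear, hT5e, hT6e]
    ring
  -- (5) the bounds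
  have hnorm_cpow_a : ∀ w : ℂ, ‖(a : ℂ) ^ w‖ = a ^ w.re := fun w =>
    Complex.norm_cpow_eq_rpow_re_of_pos ha w
  have hnorm_cpow_N : ∀ w : ℂ, ‖(N : ℂ) ^ w‖ = (N : ℝ) ^ w.re := fun w => by
    rw [show (N : ℂ) = ((N : ℝ) : ℂ) by simp, Complex.norm_cpow_eq_rpow_re_of_pos hNpos]
  have hT1 : ‖EM‖ ≤ (N : ℝ) ^ (-(1 / 2 : ℝ)) * (1 / 2 + ‖s‖) := by
    have h := norm_zeta_sub_sum_add_le hσ0 hs1 hN1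
    rw [hsre] at h
    simp only [hEM, hSN]
    convert h using 2; norm_num
  have hT3 : ‖RA‖ ≤ ‖s‖ * a ^ (-(1 / 2 : ℝ) - 1) * (N - a + 2) * sawEta V := by
    have h := norm_sum_Ioc_cpow_sub_expansion_le hσ0 hs1 ha hNreal hV1 (V := V)
    rw [hsre] at h
    simp only [hRA, hMainA, hS3, hcν, hIp, hIn]
    exact h
  have hT5 : ‖T5e‖ ≤ a ^ (-(1 / 2 : ℝ)) / 2 := by
    simp only [hT5e]
    rw [norm_mul, hnorm_cpow_a, Complex.norm_real, Real.norm_eq_abs, neg_re, hsre]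
    have := abs_saw_le a
    have h0 : (0 : ℝ) ≤ a ^ (-(1 / 2 : ℝ)) := by positivity
    nlinarith
  have hT6 : ‖T6e‖ ≤ (N : ℝ) ^ (-(1 / 2 : ℝ)) / 2 := by
    simp only [hT6e]
    rw [norm_neg, norm_mul, hnorm_cpow_N, Complex.norm_real, Real.norm_eq_abs, neg_re, hsre]
    have := abs_saw_le (N : ℝ)
    have h0 : (0 : ℝ) ≤ (N : ℝ) ^ (-(1 / 2 : ℝ)) := by positivity
    nlinarith
  -- near terms: generic part `ν ≤ n - 1` and the adjacent frequency `ν = n`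
  have hT7 : ‖JS - CY‖ ≤ (4 * (N : ℝ) ^ (-(1 / 2 : ℝ)) / π * (1 + Real.log n)
        + (n - 1 : ℕ) * (a ^ (1 / 2 : ℝ) / t)
        + 2 / π * a ^ (-(1 / 2 : ℝ)) * (1 + Real.log n))
      + (if 1 ≤ n then 4 * (N : ℝ) ^ (-(1 / 2 : ℝ)) / π + a ^ (1 / 2 : ℝ) / t else 0)
      + (if 1 ≤ n then Δ₀ * (a / 2) ^ (-(1 / 2 : ℝ))
          + 2 / π * a ^ (1 / 2 : ℝ) / (a * Int.fract y + n * Δ₀) else 0) := by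
    have e1 : a ^ (1 - (1 / 2 : ℝ)) = a ^ (1 / 2 : ℝ) := by norm_num
    rcases Nat.eq_zero_or_pos n with hn0 | hnpos
    · -- no near frequencies
      have hJS0 : JS = 0 := by rw [hJS, hn0]; rfl
      have hCY0 : CY = 0 := by rw [hCY, hn0]; simp
      have h1 : ¬ (1 ≤ n) := by omega
      rw [hJS0, hCY0, sub_zero, norm_zero, if_neg h1, if_neg h1, hn0]
      simp only [Nat.cast_zero, Real.log_zero, add_zero, Nat.zero_sub, zero_mul, mul_one]
      positivity
    · have hn1 : 1 ≤ n := hnpos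
      rw [if_pos hn1, if_pos hn1]
      obtain ⟨m, hm⟩ : ∃ m, n = m + 1 := ⟨n - 1, by omega⟩
      have hmsub : (n - 1 : ℕ) = m := by omega
      have hJSsplit : JS = (∑ ν ∈ Finset.Icc 1 m, J ν) + J n := by
        rw [hJS, hm, Finset.sum_Icc_succ_top (by omega)]
      have hCYsplit : CY = C * (∑ ν ∈ Finset.Icc 1 m, (ν : ℂ) ^ (s - 1))
          + C * (n : ℂ) ^ (s - 1) := by
        rw [hCY, hm, Finset.sum_Icc_succ_top (by omega), mul_add]
      have hmy : (m : ℝ) + 1 ≤ y := by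
        have h : ((m + 1 : ℕ) : ℝ) ≤ y := by rw [← hm]; exact hfl
        push_cast at h; exact h
      have hnR : (1 : ℝ) ≤ n := by exact_mod_cast hn1
      have hA : ‖(∑ ν ∈ Finset.Icc 1 m, J ν) - C * ∑ ν ∈ Finset.Icc 1 m, (ν : ℂ) ^ (s - 1)‖
          ≤ 4 * (N : ℝ) ^ (-(1 / 2 : ℝ)) / π * (1 + Real.log n) + m * (a ^ (1 / 2 : ℝ) / t)
            + 2 / π * a ^ (-(1 / 2 : ℝ)) * (1 + Real.log n) := by
        have h := norm_sum_near_generic_half hsre ha hty' hmy hNreal htN' (m := m)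
        rw [hsim] at h
        have hlogm : Real.log ((m : ℝ) + 1) = Real.log n := by rw [hm]; push_cast; ring_nf
        rw [hlogm] at h
        simpa only [hJ, hC] using h
      have hB : ‖J n - C * (n : ℂ) ^ (s - 1)‖
          ≤ 4 * (N : ℝ) ^ (-(1 / 2 : ℝ)) / π * (1 / n) + a ^ (1 / 2 : ℝ) / t
            + Δ₀ * (a / 2) ^ (-(1 / 2 : ℝ))
            + 2 / π * a ^ (1 / 2 : ℝ) / (a * Int.fract y + n * Δ₀) := by
        have hpos : 0 < a * (y - n) + n * Δ₀ := by
          have h := hΔ0pos hn1; rw [hfract] at h; exact h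
        have h := near_term_split_le hσ0 hσ1 ha hty' hn1 hfl hΔ0 hΔ0a hpos hNreal htN'
        rw [hsre, hsim, e1, ← hfract] at h
        simpa only [hJ, hC] using h
      have h1n : 4 * (N : ℝ) ^ (-(1 / 2 : ℝ)) / π * (1 / (n : ℝ))
          ≤ 4 * (N : ℝ) ^ (-(1 / 2 : ℝ)) / π := by
        have h0 : 0 ≤ 4 * (N : ℝ) ^ (-(1 / 2 : ℝ)) / π := by positivity
        have : 1 / (n : ℝ) ≤ 1 := by rw [div_le_one (by linarith)]; exact hnR
        exact mul_le_of_le_one_right h0 this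
      rw [hJSsplit, hCYsplit]
      have htri : ‖(∑ ν ∈ Finset.Icc 1 m, J ν) + J n
            - (C * ∑ ν ∈ Finset.Icc 1 m, (ν : ℂ) ^ (s - 1) + C * (n : ℂ) ^ (s - 1))‖
          ≤ ‖(∑ ν ∈ Finset.Icc 1 m, J ν) - C * ∑ ν ∈ Finset.Icc 1 m, (ν : ℂ) ^ (s - 1)‖
            + ‖J n - C * (n : ℂ) ^ (s - 1)‖ := by
        rw [show (∑ ν ∈ Finset.Icc 1 m, J ν) + J n
            - (C * ∑ ν ∈ Finset.Icc 1 m, (ν : ℂ) ^ (s - 1) + C * (n : ℂ) ^ (s - 1))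
            = ((∑ ν ∈ Finset.Icc 1 m, J ν) - C * ∑ ν ∈ Finset.Icc 1 m, (ν : ℂ) ^ (s - 1))
              + (J n - C * (n : ℂ) ^ (s - 1)) by ring]
        exact norm_add_le _ _
      rw [hmsub]
      linarith only [htri, hA, hB, h1n]
  have hT9 : ‖-BS‖ ≤ ((N : ℝ) ^ (-(1 / 2 : ℝ)) + a ^ (-(1 / 2 : ℝ))) / (2 * π)
      * (1 + Real.log (n + 1)) := by
    rw [norm_neg]
    have h := norm_sum_boundary_le (s := s) ha hNpos n
    rw [hsre] at h
    simp only [hBS, hBd]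
    exact (norm_sum_le _ _).trans h
  have hT10a : ‖FarP1‖ ≤ ‖s‖ / (2 * π * (n + 1)) * (Δ₁ * a ^ (-(1 / 2 : ℝ) - 1)
      + 2 / π * a ^ (-(1 / 2 : ℝ)) / (a * (1 - Int.fract y) + (n + 1) * Δ₁)) := by
    have hpos : 0 < a * ((n + 1 : ℕ) - y) + (n + 1 : ℕ) * Δ₁ := by
      push_cast
      have : 0 < a * ((n : ℝ) + 1 - y) := mul_pos ha (by linarith)
      positivity
    have h := far_pos_term_split_le hσ0 ha hty' (ν := n + 1) (by omega) hΔ1 hpos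
      (N := N) haN
    rw [hsre] at h
    simp only [hFarP1, hcν, hIp]
    refine h.trans (le_of_eq ?_)
    rw [hfract]
    push_cast
    ring_nf
  have hT10b : ‖FarP2‖ ≤ ‖s‖ * a ^ (-(1 / 2 : ℝ) - 1) / π ^ 2
      * ((1 + Real.log (n + 2)) / (n + 1)) := by
    have h := norm_sum_far_pos_generic_half hsre ha hty' hNreal (V := V)
    simp only [hFarP2, hcν, hIp]
    exact (norm_sum_le _ _).trans h
  have hT11 : ‖-Neg‖ ≤ (if (1 : ℝ) ≤ y then
        2 * ‖s‖ * a ^ (-(1 / 2 : ℝ)) / (π * t) * (1 + Real.log (n + 1))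
          + ‖s‖ * a ^ (-(1 / 2 : ℝ) - 1) / π ^ 2 * (1 / n)
      else 2 * ‖s‖ * a ^ (-(1 / 2 : ℝ) - 1) / π ^ 2) := by
    rw [norm_neg]
    split_ifs with hy1
    · have h := norm_sum_far_neg_le hσ0 ha hy1 hty' hNreal (V := V)
      rw [hsre, hsim] at h
      simp only [hNeg, hcν, hIn]
      exact (norm_sum_le _ _).trans h
    · have hsmall := norm_sum_far_neg_small_half hsre (by rw [hsim]; exact ht0.le) ha hNreal (V := V)
      simp only [hNeg, hcν, hIn]
      exact (norm_sum_le _ _).trans hsmall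
  -- (6) add up
  rw [hident]
  refine (norm_add_le_of_le (norm_add_le_of_le (norm_add_le_of_le (norm_add_le_of_le
    (norm_add_le_of_le (norm_add_le_of_le (norm_add_le_of_le (norm_add_le_of_le hT1 hT3) hT5)
    hT6) hT7) hT9) hT10a) hT10b) hT11).trans (le_of_eq ?_)
  ring

end Summit.RiemannHypothesis.RiemannHypothesis.Theorems.EtaLeadingQuarter.SecondMomentAFE

end
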